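import Literature.Analysis.Calculus.SmoothCutoff
import Literature.Analysis.FluidPDE.AxisymVorticityAlgebra
import HarnessLib

/-!
# Smooth weights for Ladyzhenskaya's weighted enstrophy estimate: axis and ball cutoffs

Analysis/FluidPDE support file (all results proved, no definitions) on the decomposition path of
the named fact `Literature.Analysis.FluidPDE.axisymmetricNoSwirl_enstrophy_apriori`
(Lemarié-Rieusset 2016, Thm. 10.4). The proof of Ladyzhenskaya's key estimate
`∫ |ω(t)|² r⁻² dx ≤ ‖ω₀‖²_{Ḣ¹}` ((10.25)–(10.27), pp. 286–288) integrates the enstrophy identity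
against the weight `α_ε(r) r⁻²`, where "`α` is smooth on `(0, +∞)`, equal to `0` on `(0, 1)` and
to `1` on `(2, +∞)`, and `α_ε(r) = α(r/ε)`" (p. 286), and lets `ε → 0`. On the whole space one
also needs an outer cutoff `χ_R → 1`. This file supplies both weights as explicit smooth
functions of `ρ = x₀² + x₁²` and `|x|²` built from Mathlib's `Real.smoothTransition` (no new
definitions are introduced; the weights are written out in each statement):

* the **axis cutoff** `α_ε(x) = smoothTransition (ρ/ε² − 1)` (`= 0` for `ρ ≤ ε²`, `= 1` for
  `ρ ≥ 2ε²`): smoothness, the derivative `Dα_ε(x)h = sT'(ρ/ε² − 1) · 2(x₀h₀ + x₁h₁)/ε²`,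
  monotonicity in `ρ` (`x₀∂₀α_ε + x₁∂₁α_ε ≥ 0`, the sign that makes the axis boundary term of
  p. 288 harmless), and the size bound `‖Dα_ε‖ ≤ (2√2 D/ε) 𝟙_{ρ ≤ 2ε²}`;
* the **ball cutoff** `χ_R(x) = smoothTransition (2 − |x|²/R²)²` (`= 1` on `|x| ≤ R`, `= 0` for
  `|x|² ≥ 2R²`): smoothness, compact support, `‖Dχ_R‖ ≤ (4√2 D/R) √χ_R` (the square makes
  `|∇χ_R|²/χ_R ≲ R⁻²`, used to absorb a cross term by the dissipation) and
  `|x₀∂₀χ_R + x₁∂₁χ_R| ≤ 4Dρ/R²`;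
* the **weight** `η_{ε,R} = α_ε χ_R / ρ`: smooth on all of `ℝ³` (it vanishes for `ρ < ε²`),
  compactly supported, nonnegative, Lipschitz;
* two measure-theoretic facts: the axis `{ρ = 0}` is Lebesgue-null, and the thin cylinder
  `{ρ ≤ a², |x|² ≤ b²}` has volume `≤ 8a²b` (it lies in a box).

Here `D` is any bound for `|smoothTransition'|`
(`Calculus.exists_bound_deriv_smoothTransition`).

## References

* P. G. Lemarié-Rieusset, *The Navier–Stokes Problem in the 21st Century*, CRC Press (2016),
  §10.3, proof of Thm. 10.4, pp. 286–288 (the weights `α_ε`, `r^η α_ε r⁻²`).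
  [LemarieRieusset2016]
-/

noncomputable section

open Set Function Filter MeasureTheory Metric
open scoped RealInnerProductSpace ENNReal NNReal Topology

namespace Literature.Analysis.FluidPDE

/-! ### The axis cutoff `α_ε(x) = smoothTransition (ρ/ε² − 1)` -/

section AxisCutoff

/-- `α_ε` is smooth. [folklore] -/
theorem contDiff_axisCutoff (ε : ℝ) {n : ℕ∞} :
    ContDiff ℝ n (fun x : EuclideanSpace ℝ (Fin 3) =>
      Real.smoothTransition ((x 0 ^ 2 + x 1 ^ 2) / ε ^ 2 - 1)) :=
  Real.smoothTransition.contDiff.comp ((contDiff_horizSq.div_const _).sub contDiff_const)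

/-- `0 ≤ α_ε`. [folklore] -/
theorem axisCutoff_nonneg (ε : ℝ) (x : EuclideanSpace ℝ (Fin 3)) :
    0 ≤ Real.smoothTransition ((x 0 ^ 2 + x 1 ^ 2) / ε ^ 2 - 1) :=
  Real.smoothTransition.nonneg _

/-- `α_ε ≤ 1`. [folklore] -/
theorem axisCutoff_le_one (ε : ℝ) (x : EuclideanSpace ℝ (Fin 3)) :
    Real.smoothTransition ((x 0 ^ 2 + x 1 ^ 2) / ε ^ 2 - 1) ≤ 1 :=
  Real.smoothTransition.le_one _

/-- `α_ε = 0` for `ρ ≤ ε²` ("equal to `0` on `(0, 1)`").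
[cite: LemarieRieusset2016, §10.3 p. 286 (α_ε)] -/
theorem axisCutoff_eq_zero {ε : ℝ} (hε : 0 < ε) {x : EuclideanSpace ℝ (Fin 3)}
    (hx : x 0 ^ 2 + x 1 ^ 2 ≤ ε ^ 2) :
    Real.smoothTransition ((x 0 ^ 2 + x 1 ^ 2) / ε ^ 2 - 1) = 0 :=
  Real.smoothTransition.zero_of_nonpos (by
    have : (x 0 ^ 2 + x 1 ^ 2) / ε ^ 2 ≤ 1 := (div_le_one (by positivity)).2 hx
    linarith)

/-- `α_ε = 1` for `ρ ≥ 2ε²` ("equal to `1` on `(2, +∞)`").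
[cite: LemarieRieusset2016, §10.3 p. 286 (α_ε)] -/
theorem axisCutoff_eq_one {ε : ℝ} (hε : 0 < ε) {x : EuclideanSpace ℝ (Fin 3)}
    (hx : 2 * ε ^ 2 ≤ x 0 ^ 2 + x 1 ^ 2) :
    Real.smoothTransition ((x 0 ^ 2 + x 1 ^ 2) / ε ^ 2 - 1) = 1 :=
  Real.smoothTransition.one_of_one_le (by
    have : 2 ≤ (x 0 ^ 2 + x 1 ^ 2) / ε ^ 2 := (le_div_iff₀ (by positivity)).2 hx
    linarith)

/-- **The derivative of the axis cutoff**: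
`Dα_ε(x) h = sT'(ρ/ε² − 1) · 2(x₀h₀ + x₁h₁)/ε²`. [folklore] -/
theorem fderiv_axisCutoff_apply (ε : ℝ) (x h : EuclideanSpace ℝ (Fin 3)) :
    fderiv ℝ (fun y : EuclideanSpace ℝ (Fin 3) =>
        Real.smoothTransition ((y 0 ^ 2 + y 1 ^ 2) / ε ^ 2 - 1)) x h =
      deriv Real.smoothTransition ((x 0 ^ 2 + x 1 ^ 2) / ε ^ 2 - 1) *
        (2 * (x 0 * h 0 + x 1 * h 1) / ε ^ 2) := by
  have hρ : HasFDerivAt (fun y : EuclideanSpace ℝ (Fin 3) => (y 0 ^ 2 + y 1 ^ 2) / ε ^ 2 - 1)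
      ((ε ^ 2)⁻¹ •
        ((2 * x 0) • (EuclideanSpace.proj (0 : Fin 3) : EuclideanSpace ℝ (Fin 3) →L[ℝ] ℝ) +
          (2 * x 1) • (EuclideanSpace.proj (1 : Fin 3) : EuclideanSpace ℝ (Fin 3) →L[ℝ] ℝ)))
      x := by
    have h := ((hasFDerivAt_horizSq x).const_mul (ε ^ 2)⁻¹).sub_const 1
    have heq : (fun y : EuclideanSpace ℝ (Fin 3) => (y 0 ^ 2 + y 1 ^ 2) / ε ^ 2 - 1) =
        fun y => (ε ^ 2)⁻¹ * (y 0 ^ 2 + y 1 ^ 2) - 1 := funext fun y => by ring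
    rw [heq]; exact h
  have hc : HasFDerivAt (fun y : EuclideanSpace ℝ (Fin 3) =>
      Real.smoothTransition ((y 0 ^ 2 + y 1 ^ 2) / ε ^ 2 - 1))
      (deriv Real.smoothTransition ((x 0 ^ 2 + x 1 ^ 2) / ε ^ 2 - 1) • ((ε ^ 2)⁻¹ •
        ((2 * x 0) • (EuclideanSpace.proj (0 : Fin 3) : EuclideanSpace ℝ (Fin 3) →L[ℝ] ℝ) +
          (2 * x 1) • (EuclideanSpace.proj (1 : Fin 3) : EuclideanSpace ℝ (Fin 3) →L[ℝ] ℝ))))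
      x :=
    (Calculus.differentiable_smoothTransition _).hasDerivAt.comp_hasFDerivAt x hρ
  rw [hc.fderiv]
  simp [EuclideanSpace.proj]
  ring

/-- `α_ε` is differentiable. [folklore] -/
theorem differentiable_axisCutoff (ε : ℝ) :
    Differentiable ℝ (fun x : EuclideanSpace ℝ (Fin 3) =>
      Real.smoothTransition ((x 0 ^ 2 + x 1 ^ 2) / ε ^ 2 - 1)) :=
  (contDiff_axisCutoff ε (n := 1)).differentiable (by simp)

/-- **Monotonicity of the axis cutoff in `ρ`**:
`x₀ ∂₀α_ε + x₁ ∂₁α_ε = 2 sT'(ρ/ε² − 1) ρ/ε² ≥ 0` (`α` is nondecreasing). This is the sign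
which makes the axis boundary term of the weighted estimate nonpositive (Lemarié-Rieusset 2016,
p. 288: the terms carrying `∂ᵣ(r^η α_ε)`). [cite: LemarieRieusset2016, §10.3 p. 288] -/
theorem horizontal_fderiv_axisCutoff_nonneg (ε : ℝ) (x : EuclideanSpace ℝ (Fin 3)) :
    0 ≤ x 0 * fderiv ℝ (fun y : EuclideanSpace ℝ (Fin 3) =>
          Real.smoothTransition ((y 0 ^ 2 + y 1 ^ 2) / ε ^ 2 - 1)) x
            (EuclideanSpace.single 0 (1 : ℝ)) +
        x 1 * fderiv ℝ (fun y : EuclideanSpace ℝ (Fin 3) =>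
          Real.smoothTransition ((y 0 ^ 2 + y 1 ^ 2) / ε ^ 2 - 1)) x
            (EuclideanSpace.single 1 (1 : ℝ)) := by
  rw [fderiv_axisCutoff_apply, fderiv_axisCutoff_apply]
  simp only [PiLp.single_apply]
  simp only [Fin.isValue, ↓reduceIte, mul_one, one_ne_zero, mul_zero, add_zero, zero_ne_one,
    zero_add]
  have h1 : 0 ≤ deriv Real.smoothTransition ((x 0 ^ 2 + x 1 ^ 2) / ε ^ 2 - 1) :=
    Real.smoothTransition.monotone.deriv_nonneg
  have h2 : 0 ≤ (x 0 ^ 2 + x 1 ^ 2) / ε ^ 2 := by positivity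
  have h3 : x 0 * (deriv Real.smoothTransition ((x 0 ^ 2 + x 1 ^ 2) / ε ^ 2 - 1) *
      (2 * x 0 / ε ^ 2)) +
      x 1 * (deriv Real.smoothTransition ((x 0 ^ 2 + x 1 ^ 2) / ε ^ 2 - 1) *
      (2 * x 1 / ε ^ 2)) =
      2 * (deriv Real.smoothTransition ((x 0 ^ 2 + x 1 ^ 2) / ε ^ 2 - 1) *
        ((x 0 ^ 2 + x 1 ^ 2) / ε ^ 2)) := by ring
  rw [h3]
  exact mul_nonneg (by norm_num) (mul_nonneg h1 h2)

/-- **Size of the derivative of the axis cutoff**: `‖Dα_ε(x)‖ ≤ 2D√ρ/ε² ≤ 2√2 D/ε` where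
`ρ ≤ 2ε²`, and `Dα_ε(x) = 0` where `ρ > 2ε²` (`D` a bound for `|sT'|`): the derivative lives on
the shell `ε² < ρ < 2ε²` and is `O(1/ε)` there (Lemarié-Rieusset 2016, p. 287:
`|∂ᵣα_ε| ≤ ‖α'‖_∞/ε` on `ε < r < 2ε`). [cite: LemarieRieusset2016, §10.3 p. 287] -/
theorem norm_fderiv_axisCutoff_le {D : ℝ} (hD : ∀ t, |deriv Real.smoothTransition t| ≤ D)
    {ε : ℝ} (hε : 0 < ε) (x : EuclideanSpace ℝ (Fin 3)) :
    ‖fderiv ℝ (fun y : EuclideanSpace ℝ (Fin 3) =>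
        Real.smoothTransition ((y 0 ^ 2 + y 1 ^ 2) / ε ^ 2 - 1)) x‖ ≤
      if x 0 ^ 2 + x 1 ^ 2 ≤ 2 * ε ^ 2 then 2 * Real.sqrt 2 * D / ε else 0 := by
  have hD0 : 0 ≤ D := (abs_nonneg _).trans (hD 0)
  split_ifs with hle
  · refine ContinuousLinearMap.opNorm_le_bound _ (by positivity) fun h => ?_
    rw [fderiv_axisCutoff_apply, Real.norm_eq_abs, abs_mul]
    have h1 := hD ((x 0 ^ 2 + x 1 ^ 2) / ε ^ 2 - 1)
    have h2 := abs_horizontal_inner_le x h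
    have h3 : Real.sqrt (x 0 ^ 2 + x 1 ^ 2) ≤ Real.sqrt 2 * ε := by
      rw [← Real.sqrt_sq hε.le, ← Real.sqrt_mul (by norm_num)]
      exact Real.sqrt_le_sqrt (by linarith)
    have h4 : |2 * (x 0 * h 0 + x 1 * h 1) / ε ^ 2| = 2 * |x 0 * h 0 + x 1 * h 1| / ε ^ 2 := by
      rw [abs_div, abs_mul, abs_of_pos (by norm_num : (0:ℝ) < 2),
        abs_of_pos (by positivity : (0:ℝ) < ε ^ 2)]
    rw [h4]
    calc |deriv Real.smoothTransition ((x 0 ^ 2 + x 1 ^ 2) / ε ^ 2 - 1)| *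
          (2 * |x 0 * h 0 + x 1 * h 1| / ε ^ 2)
        ≤ D * (2 * (Real.sqrt 2 * ε * ‖h‖) / ε ^ 2) := by
          gcongr
          exact h2.trans (mul_le_mul_of_nonneg_right h3 (norm_nonneg _))
      _ = 2 * Real.sqrt 2 * D / ε * ‖h‖ := by field_simp
  · push Not at hle
    have hz : fderiv ℝ (fun y : EuclideanSpace ℝ (Fin 3) =>
        Real.smoothTransition ((y 0 ^ 2 + y 1 ^ 2) / ε ^ 2 - 1)) x = 0 := by
      ext h
      rw [fderiv_axisCutoff_apply, Calculus.deriv_smoothTransition_of_one_le ?_]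
      · simp
      · have : 2 ≤ (x 0 ^ 2 + x 1 ^ 2) / ε ^ 2 := by
          rw [le_div_iff₀ (by positivity)]; linarith
        linarith
    rw [hz, norm_zero]

/-- Off the axis the axis cutoffs `α_{1/(n+1)}` are eventually `1`. [folklore] -/
theorem eventually_axisCutoff_eq_one {x : EuclideanSpace ℝ (Fin 3)} (hx : x 0 ^ 2 + x 1 ^ 2 ≠ 0) :
    ∀ᶠ n : ℕ in atTop,
      Real.smoothTransition ((x 0 ^ 2 + x 1 ^ 2) / ((1 : ℝ) / (n + 1)) ^ 2 - 1) = 1 := by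
  have hρ : 0 < x 0 ^ 2 + x 1 ^ 2 := lt_of_le_of_ne (by positivity) (Ne.symm hx)
  obtain ⟨N, hN⟩ := exists_nat_gt (2 / (x 0 ^ 2 + x 1 ^ 2))
  refine eventually_atTop.2 ⟨N, fun n hn => ?_⟩
  have hn' : (2 : ℝ) / (x 0 ^ 2 + x 1 ^ 2) < (n : ℝ) + 1 := by
    have : (N : ℝ) ≤ n := by exact_mod_cast hn
    linarith
  refine axisCutoff_eq_one (by positivity) ?_
  rw [div_lt_iff₀ hρ] at hn'
  have h1 : ((1 : ℝ) / (n + 1)) ^ 2 = 1 / ((n : ℝ) + 1) ^ 2 := by rw [div_pow, one_pow]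
  rw [h1]
  have hpos : (0 : ℝ) < (n : ℝ) + 1 := by positivity
  rw [show 2 * (1 / ((n : ℝ) + 1) ^ 2) = 2 / ((n : ℝ) + 1) ^ 2 by ring, div_le_iff₀ (by positivity)]
  nlinarith [hn', hρ]

end AxisCutoff

/-! ### The ball cutoff `χ_R(x) = smoothTransition (2 − |x|²/R²)²` -/

section SqBallCutoff

/-- `χ_R` is smooth. [folklore] -/
theorem contDiff_sqBallCutoff (R : ℝ) {n : ℕ∞} :
    ContDiff ℝ n (fun x : EuclideanSpace ℝ (Fin 3) =>
      Real.smoothTransition (2 - ‖x‖ ^ 2 / R ^ 2) ^ 2) :=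
  (Real.smoothTransition.contDiff.comp
    (contDiff_const.sub ((contDiff_norm_sq ℝ).div_const _))).pow 2

/-- `χ_R` is differentiable. [folklore] -/
theorem differentiable_sqBallCutoff (R : ℝ) :
    Differentiable ℝ (fun x : EuclideanSpace ℝ (Fin 3) =>
      Real.smoothTransition (2 - ‖x‖ ^ 2 / R ^ 2) ^ 2) :=
  (contDiff_sqBallCutoff R (n := 1)).differentiable (by simp)

/-- `0 ≤ χ_R`. [folklore] -/
theorem sqBallCutoff_nonneg (R : ℝ) (x : EuclideanSpace ℝ (Fin 3)) :
    0 ≤ Real.smoothTransition (2 - ‖x‖ ^ 2 / R ^ 2) ^ 2 := sq_nonneg _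

/-- `χ_R ≤ 1`. [folklore] -/
theorem sqBallCutoff_le_one (R : ℝ) (x : EuclideanSpace ℝ (Fin 3)) :
    Real.smoothTransition (2 - ‖x‖ ^ 2 / R ^ 2) ^ 2 ≤ 1 := by
  have h0 := Real.smoothTransition.nonneg (2 - ‖x‖ ^ 2 / R ^ 2)
  have h1 := Real.smoothTransition.le_one (2 - ‖x‖ ^ 2 / R ^ 2)
  nlinarith

/-- `χ_R = 1` on the ball `|x| ≤ R`. [folklore] -/
theorem sqBallCutoff_eq_one {R : ℝ} (hR : 0 < R) {x : EuclideanSpace ℝ (Fin 3)} (hx : ‖x‖ ≤ R) :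
    Real.smoothTransition (2 - ‖x‖ ^ 2 / R ^ 2) ^ 2 = 1 := by
  have h : ‖x‖ ^ 2 / R ^ 2 ≤ 1 := by
    rw [div_le_one (by positivity)]
    exact pow_le_pow_left₀ (norm_nonneg _) hx 2
  rw [Real.smoothTransition.one_of_one_le (by linarith), one_pow]

/-- `χ_R = 0` where `|x|² ≥ 2R²`. [folklore] -/
theorem sqBallCutoff_eq_zero {R : ℝ} (hR : 0 < R) {x : EuclideanSpace ℝ (Fin 3)}
    (hx : 2 * R ^ 2 ≤ ‖x‖ ^ 2) :
    Real.smoothTransition (2 - ‖x‖ ^ 2 / R ^ 2) ^ 2 = 0 := by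
  have h : 2 ≤ ‖x‖ ^ 2 / R ^ 2 := by rwa [le_div_iff₀ (by positivity)]
  rw [Real.smoothTransition.zero_of_nonpos (by linarith)]
  ring

/-- `χ_R` is supported in the closed ball of radius `√2 R`. [folklore] -/
theorem sqBallCutoff_eq_zero_of_norm {R : ℝ} (hR : 0 < R) {x : EuclideanSpace ℝ (Fin 3)}
    (hx : Real.sqrt 2 * R ≤ ‖x‖) :
    Real.smoothTransition (2 - ‖x‖ ^ 2 / R ^ 2) ^ 2 = 0 := by
  refine sqBallCutoff_eq_zero hR ?_
  have h0 : 0 ≤ Real.sqrt 2 * R := by positivity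
  calc 2 * R ^ 2 = (Real.sqrt 2 * R) ^ 2 := by
        rw [mul_pow, Real.sq_sqrt (by norm_num : (0:ℝ) ≤ 2)]
    _ ≤ ‖x‖ ^ 2 := pow_le_pow_left₀ h0 hx 2

/-- `χ_R` has compact support. [folklore] -/
theorem hasCompactSupport_sqBallCutoff {R : ℝ} (hR : 0 < R) :
    HasCompactSupport (fun x : EuclideanSpace ℝ (Fin 3) =>
      Real.smoothTransition (2 - ‖x‖ ^ 2 / R ^ 2) ^ 2) := by
  refine HasCompactSupport.of_support_subset_isCompact (isCompact_closedBall 0 (Real.sqrt 2 * R))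
    fun x hx => ?_
  rw [mem_closedBall, dist_zero_right]
  by_contra h
  push Not at h
  exact hx (sqBallCutoff_eq_zero_of_norm hR h.le)

/-- **The derivative of the ball cutoff**:
`Dχ_R(x) h = −4 sT(s) sT'(s) ⟪x, h⟫ / R²`, `s = 2 − |x|²/R²`. [folklore] -/
theorem fderiv_sqBallCutoff_apply (R : ℝ) (x h : EuclideanSpace ℝ (Fin 3)) :
    fderiv ℝ (fun y : EuclideanSpace ℝ (Fin 3) =>
        Real.smoothTransition (2 - ‖y‖ ^ 2 / R ^ 2) ^ 2) x h =
      -(4 * Real.smoothTransition (2 - ‖x‖ ^ 2 / R ^ 2) *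
          deriv Real.smoothTransition (2 - ‖x‖ ^ 2 / R ^ 2) * ⟪x, h⟫ / R ^ 2) := by
  have hs : HasFDerivAt (fun y : EuclideanSpace ℝ (Fin 3) => 2 - ‖y‖ ^ 2 / R ^ 2)
      (-((R ^ 2)⁻¹ • (2 • innerSL ℝ x))) x := by
    have h1 := ((hasStrictFDerivAt_norm_sq x).hasFDerivAt.const_mul (R ^ 2)⁻¹).const_sub 2
    have heq : (fun y : EuclideanSpace ℝ (Fin 3) => 2 - ‖y‖ ^ 2 / R ^ 2) =
        fun y => 2 - (R ^ 2)⁻¹ * ‖y‖ ^ 2 := funext fun y => by ring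
    rw [heq]; exact h1
  have hg := (Calculus.differentiable_smoothTransition _).hasDerivAt.comp_hasFDerivAt x hs
  have hχ := hg.pow 2
  have hχ' : HasFDerivAt (fun y : EuclideanSpace ℝ (Fin 3) =>
      Real.smoothTransition (2 - ‖y‖ ^ 2 / R ^ 2) ^ 2) _ x := hχ
  rw [hχ'.fderiv]
  simp [innerSL_apply_apply]
  ring

/-- **Size of the derivative of the ball cutoff**: `‖Dχ_R(x)‖ ≤ (4√2 D/R) sT(2 − |x|²/R²)`
(`D` a bound for `|sT'|`); in particular `‖Dχ_R‖ ≤ 4√2 D/R` and `‖Dχ_R‖² ≤ 32 D² χ_R/R²`.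
[folklore] -/
theorem norm_fderiv_sqBallCutoff_le {D : ℝ} (hD : ∀ t, |deriv Real.smoothTransition t| ≤ D)
    {R : ℝ} (hR : 0 < R) (x : EuclideanSpace ℝ (Fin 3)) :
    ‖fderiv ℝ (fun y : EuclideanSpace ℝ (Fin 3) =>
        Real.smoothTransition (2 - ‖y‖ ^ 2 / R ^ 2) ^ 2) x‖ ≤
      4 * Real.sqrt 2 * D / R * Real.smoothTransition (2 - ‖x‖ ^ 2 / R ^ 2) := by
  have hD0 : 0 ≤ D := (abs_nonneg _).trans (hD 0)
  have hsT0 := Real.smoothTransition.nonneg (2 - ‖x‖ ^ 2 / R ^ 2)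
  by_cases hx : 2 * R ^ 2 ≤ ‖x‖ ^ 2
  · -- outside the support everything vanishes
    have h : 2 ≤ ‖x‖ ^ 2 / R ^ 2 := by rwa [le_div_iff₀ (by positivity)]
    have hz : fderiv ℝ (fun y : EuclideanSpace ℝ (Fin 3) =>
        Real.smoothTransition (2 - ‖y‖ ^ 2 / R ^ 2) ^ 2) x = 0 := by
      ext h'
      rw [fderiv_sqBallCutoff_apply, Real.smoothTransition.zero_of_nonpos (by linarith)]
      simp
    rw [hz, norm_zero]
    positivity
  · push Not at hx
    have hxR : ‖x‖ ≤ Real.sqrt 2 * R := by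
      have h0 : 0 ≤ Real.sqrt 2 * R := by positivity
      refine le_of_pow_le_pow_left₀ two_ne_zero h0 ?_
      rw [mul_pow, Real.sq_sqrt (by norm_num : (0:ℝ) ≤ 2)]
      exact hx.le
    refine ContinuousLinearMap.opNorm_le_bound _ (by positivity) fun h => ?_
    rw [fderiv_sqBallCutoff_apply, norm_neg, Real.norm_eq_abs, abs_div, abs_mul, abs_mul, abs_mul,
      abs_of_pos (by norm_num : (0:ℝ) < 4), abs_of_nonneg hsT0,
      abs_of_pos (by positivity : 0 < R ^ 2)]
    have h1 := hD (2 - ‖x‖ ^ 2 / R ^ 2)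
    have h2 : |⟪x, h⟫| ≤ ‖x‖ * ‖h‖ := abs_real_inner_le_norm x h
    calc 4 * Real.smoothTransition (2 - ‖x‖ ^ 2 / R ^ 2) *
          |deriv Real.smoothTransition (2 - ‖x‖ ^ 2 / R ^ 2)| * |⟪x, h⟫| / R ^ 2
        ≤ 4 * Real.smoothTransition (2 - ‖x‖ ^ 2 / R ^ 2) * D * (Real.sqrt 2 * R * ‖h‖) /
            R ^ 2 := by
          gcongr
          exact h2.trans (mul_le_mul_of_nonneg_right hxR (norm_nonneg _))
      _ = 4 * Real.sqrt 2 * D / R * Real.smoothTransition (2 - ‖x‖ ^ 2 / R ^ 2) * ‖h‖ := by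
          field_simp

/-- `‖Dχ_R(x)‖ ≤ 4√2 D/R`. [folklore] -/
theorem norm_fderiv_sqBallCutoff_le' {D : ℝ} (hD : ∀ t, |deriv Real.smoothTransition t| ≤ D)
    {R : ℝ} (hR : 0 < R) (x : EuclideanSpace ℝ (Fin 3)) :
    ‖fderiv ℝ (fun y : EuclideanSpace ℝ (Fin 3) =>
        Real.smoothTransition (2 - ‖y‖ ^ 2 / R ^ 2) ^ 2) x‖ ≤ 4 * Real.sqrt 2 * D / R := by
  have hD0 : 0 ≤ D := (abs_nonneg _).trans (hD 0)
  refine (norm_fderiv_sqBallCutoff_le hD hR x).trans ?_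
  have h1 := Real.smoothTransition.le_one (2 - ‖x‖ ^ 2 / R ^ 2)
  have h0 : 0 ≤ 4 * Real.sqrt 2 * D / R := by positivity
  nlinarith

/-- **The squared-cutoff property**: `‖Dχ_R(x)‖² ≤ (32 D²/R²) χ_R(x)`. [folklore] -/
theorem norm_fderiv_sqBallCutoff_sq_le {D : ℝ} (hD : ∀ t, |deriv Real.smoothTransition t| ≤ D)
    {R : ℝ} (hR : 0 < R) (x : EuclideanSpace ℝ (Fin 3)) :
    ‖fderiv ℝ (fun y : EuclideanSpace ℝ (Fin 3) =>
        Real.smoothTransition (2 - ‖y‖ ^ 2 / R ^ 2) ^ 2) x‖ ^ 2 ≤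
      32 * D ^ 2 / R ^ 2 * Real.smoothTransition (2 - ‖x‖ ^ 2 / R ^ 2) ^ 2 := by
  have h := norm_fderiv_sqBallCutoff_le hD hR x
  have hD0 : 0 ≤ D := (abs_nonneg _).trans (hD 0)
  have h0 : 0 ≤ 4 * Real.sqrt 2 * D / R * Real.smoothTransition (2 - ‖x‖ ^ 2 / R ^ 2) := by
    have := Real.smoothTransition.nonneg (2 - ‖x‖ ^ 2 / R ^ 2)
    positivity
  calc _ ≤ (4 * Real.sqrt 2 * D / R * Real.smoothTransition (2 - ‖x‖ ^ 2 / R ^ 2)) ^ 2 :=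
        pow_le_pow_left₀ (norm_nonneg _) h 2
    _ = 16 * Real.sqrt 2 ^ 2 * D ^ 2 / R ^ 2 * Real.smoothTransition (2 - ‖x‖ ^ 2 / R ^ 2) ^ 2 := by
        ring
    _ = 32 * D ^ 2 / R ^ 2 * Real.smoothTransition (2 - ‖x‖ ^ 2 / R ^ 2) ^ 2 := by
        rw [Real.sq_sqrt (by norm_num : (0:ℝ) ≤ 2)]
        ring

/-- **The horizontal radial derivative of the ball cutoff**:
`|x₀∂₀χ_R + x₁∂₁χ_R| ≤ 4 D ρ / R²` (`ρ = x₀² + x₁²`): paired with `x_h`, the gradient of the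
radial cutoff loses its singularity at the axis. [folklore] -/
theorem abs_horizontal_fderiv_sqBallCutoff_le {D : ℝ} (hD : ∀ t, |deriv Real.smoothTransition t| ≤ D)
    (R : ℝ) (x : EuclideanSpace ℝ (Fin 3)) :
    |x 0 * fderiv ℝ (fun y : EuclideanSpace ℝ (Fin 3) =>
          Real.smoothTransition (2 - ‖y‖ ^ 2 / R ^ 2) ^ 2) x (EuclideanSpace.single 0 (1 : ℝ)) +
        x 1 * fderiv ℝ (fun y : EuclideanSpace ℝ (Fin 3) =>
          Real.smoothTransition (2 - ‖y‖ ^ 2 / R ^ 2) ^ 2) x (EuclideanSpace.single 1 (1 : ℝ))| ≤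
      4 * D * (x 0 ^ 2 + x 1 ^ 2) / R ^ 2 := by
  have hD0 : 0 ≤ D := (abs_nonneg _).trans (hD 0)
  rw [fderiv_sqBallCutoff_apply, fderiv_sqBallCutoff_apply]
  simp only [EuclideanSpace.inner_single_right, one_mul, conj_trivial]
  have hsT0 := Real.smoothTransition.nonneg (2 - ‖x‖ ^ 2 / R ^ 2)
  have hsT1 := Real.smoothTransition.le_one (2 - ‖x‖ ^ 2 / R ^ 2)
  have h1 := hD (2 - ‖x‖ ^ 2 / R ^ 2)
  set S := Real.smoothTransition (2 - ‖x‖ ^ 2 / R ^ 2)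
  set S' := deriv Real.smoothTransition (2 - ‖x‖ ^ 2 / R ^ 2)
  have heq : x 0 * -(4 * S * S' * x 0 / R ^ 2) + x 1 * -(4 * S * S' * x 1 / R ^ 2) =
      -(4 * (S * S') * (x 0 ^ 2 + x 1 ^ 2) / R ^ 2) := by ring
  rw [heq, abs_neg, abs_div, abs_mul, abs_mul, abs_of_pos (by norm_num : (0:ℝ) < 4),
    abs_of_nonneg (by positivity : 0 ≤ x 0 ^ 2 + x 1 ^ 2), abs_of_nonneg (sq_nonneg R)]
  have h2 : |S * S'| ≤ D := by
    rw [abs_mul, abs_of_nonneg hsT0]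
    calc S * |S'| ≤ 1 * D := mul_le_mul hsT1 h1 (abs_nonneg _) zero_le_one
      _ = D := one_mul D
  rcases eq_or_ne R 0 with hR | hR
  · simp [hR]
  · rw [div_le_div_iff_of_pos_right (by positivity)]
    gcongr

/-- The ball cutoffs `χ_{n+1}` are eventually `1` at every point. [folklore] -/
theorem eventually_sqBallCutoff_eq_one (x : EuclideanSpace ℝ (Fin 3)) :
    ∀ᶠ n : ℕ in atTop, Real.smoothTransition (2 - ‖x‖ ^ 2 / ((n : ℝ) + 1) ^ 2) ^ 2 = 1 := by
  obtain ⟨N, hN⟩ := exists_nat_gt ‖x‖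
  refine eventually_atTop.2 ⟨N, fun n hn => sqBallCutoff_eq_one (by positivity) ?_⟩
  have : (N : ℝ) ≤ n := by exact_mod_cast hn
  linarith

end SqBallCutoff

/-! ### The weight `η_{ε,R} = α_ε χ_R / ρ` -/

section Weight

/-- **The weight `η_{ε,R} = α_ε χ_R / ρ` is smooth on all of `ℝ³`**: near a point with
`ρ < ε²` it vanishes identically (the axis cutoff does), and elsewhere it is a quotient of smooth
functions with nonvanishing denominator (the regularised weight `α_ε(r)/r²` of
Lemarié-Rieusset 2016, p. 286, times an outer cutoff). [cite: LemarieRieusset2016, §10.3 p. 286] -/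
theorem contDiff_axisWeight {ε : ℝ} (hε : 0 < ε) (R : ℝ) {n : ℕ∞} :
    ContDiff ℝ n (fun x : EuclideanSpace ℝ (Fin 3) =>
      Real.smoothTransition ((x 0 ^ 2 + x 1 ^ 2) / ε ^ 2 - 1) *
        Real.smoothTransition (2 - ‖x‖ ^ 2 / R ^ 2) ^ 2 / (x 0 ^ 2 + x 1 ^ 2)) := by
  refine contDiff_iff_contDiffAt.2 fun x => ?_
  by_cases hx : x 0 ^ 2 + x 1 ^ 2 < ε ^ 2
  · -- the weight vanishes on the open neighbourhood `{ρ < ε²}` of `x`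
    have hopen : IsOpen {y : EuclideanSpace ℝ (Fin 3) | y 0 ^ 2 + y 1 ^ 2 < ε ^ 2} :=
      isOpen_lt (contDiff_horizSq (n := 0)).continuous continuous_const
    have hev : (fun y : EuclideanSpace ℝ (Fin 3) =>
        Real.smoothTransition ((y 0 ^ 2 + y 1 ^ 2) / ε ^ 2 - 1) *
          Real.smoothTransition (2 - ‖y‖ ^ 2 / R ^ 2) ^ 2 / (y 0 ^ 2 + y 1 ^ 2)) =ᶠ[𝓝 x]
        fun _ => 0 := by
      filter_upwards [hopen.mem_nhds hx] with y hy
      rw [axisCutoff_eq_zero hε (le_of_lt hy)]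
      simp
    exact (contDiffAt_const (c := (0 : ℝ))).congr_of_eventuallyEq hev
  · push Not at hx
    have hρ : x 0 ^ 2 + x 1 ^ 2 ≠ 0 := by
      have : 0 < ε ^ 2 := by positivity
      exact (lt_of_lt_of_le this hx).ne'
    exact (((contDiff_axisCutoff ε).mul (contDiff_sqBallCutoff R)).contDiffAt).div
      contDiff_horizSq.contDiffAt hρ

/-- The weight `η_{ε,R}` vanishes identically near every point with `ρ < ε²`. [folklore] -/
theorem axisWeight_eventuallyEq_zero {ε : ℝ} (hε : 0 < ε) (R : ℝ) {x : EuclideanSpace ℝ (Fin 3)}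
    (hx : x 0 ^ 2 + x 1 ^ 2 < ε ^ 2) :
    (fun y : EuclideanSpace ℝ (Fin 3) =>
      Real.smoothTransition ((y 0 ^ 2 + y 1 ^ 2) / ε ^ 2 - 1) *
        Real.smoothTransition (2 - ‖y‖ ^ 2 / R ^ 2) ^ 2 / (y 0 ^ 2 + y 1 ^ 2)) =ᶠ[𝓝 x]
      fun _ => 0 := by
  have hopen : IsOpen {y : EuclideanSpace ℝ (Fin 3) | y 0 ^ 2 + y 1 ^ 2 < ε ^ 2} :=
    isOpen_lt (contDiff_horizSq (n := 0)).continuous continuous_const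
  filter_upwards [hopen.mem_nhds hx] with y hy
  rw [axisCutoff_eq_zero hε (le_of_lt hy)]
  simp

/-- At a point with `ρ < ε²` the weight and its derivative vanish. [folklore] -/
theorem fderiv_axisWeight_eq_zero {ε : ℝ} (hε : 0 < ε) (R : ℝ) {x : EuclideanSpace ℝ (Fin 3)}
    (hx : x 0 ^ 2 + x 1 ^ 2 < ε ^ 2) :
    fderiv ℝ (fun y : EuclideanSpace ℝ (Fin 3) =>
      Real.smoothTransition ((y 0 ^ 2 + y 1 ^ 2) / ε ^ 2 - 1) *
        Real.smoothTransition (2 - ‖y‖ ^ 2 / R ^ 2) ^ 2 / (y 0 ^ 2 + y 1 ^ 2)) x = 0 := by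
  rw [(axisWeight_eventuallyEq_zero hε R hx).fderiv_eq]
  exact fderiv_const_apply 0

/-- `0 ≤ η_{ε,R}`. [folklore] -/
theorem axisWeight_nonneg (ε R : ℝ) (x : EuclideanSpace ℝ (Fin 3)) :
    0 ≤ Real.smoothTransition ((x 0 ^ 2 + x 1 ^ 2) / ε ^ 2 - 1) *
        Real.smoothTransition (2 - ‖x‖ ^ 2 / R ^ 2) ^ 2 / (x 0 ^ 2 + x 1 ^ 2) :=
  div_nonneg (mul_nonneg (Real.smoothTransition.nonneg _) (sq_nonneg _)) (by positivity)

/-- `η_{ε,R}` has compact support (inside the closed ball of radius `√2 R`). [folklore] -/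
theorem hasCompactSupport_axisWeight (ε : ℝ) {R : ℝ} (hR : 0 < R) :
    HasCompactSupport (fun x : EuclideanSpace ℝ (Fin 3) =>
      Real.smoothTransition ((x 0 ^ 2 + x 1 ^ 2) / ε ^ 2 - 1) *
        Real.smoothTransition (2 - ‖x‖ ^ 2 / R ^ 2) ^ 2 / (x 0 ^ 2 + x 1 ^ 2)) := by
  refine HasCompactSupport.of_support_subset_isCompact (isCompact_closedBall 0 (Real.sqrt 2 * R))
    fun x hx => ?_
  rw [mem_closedBall, dist_zero_right]
  by_contra h
  push Not at h
  apply hx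
  simp only [mem_support, ne_eq] at *
  rw [sqBallCutoff_eq_zero_of_norm hR h.le]
  simp

/-- `η_{ε,R}` is Lipschitz (it is `C¹` with compact support). [folklore] -/
theorem exists_lipschitzWith_axisWeight {ε : ℝ} (hε : 0 < ε) {R : ℝ} (hR : 0 < R) :
    ∃ K : ℝ≥0, LipschitzWith K (fun x : EuclideanSpace ℝ (Fin 3) =>
      Real.smoothTransition ((x 0 ^ 2 + x 1 ^ 2) / ε ^ 2 - 1) *
        Real.smoothTransition (2 - ‖x‖ ^ 2 / R ^ 2) ^ 2 / (x 0 ^ 2 + x 1 ^ 2)) :=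
  (contDiff_axisWeight hε R (n := 1)).lipschitzWith_of_hasCompactSupport
    (hasCompactSupport_axisWeight ε hR) one_ne_zero

/-- `χ_R` is Lipschitz (it is `C¹` with compact support). [folklore] -/
theorem exists_lipschitzWith_sqBallCutoff {R : ℝ} (hR : 0 < R) :
    ∃ K : ℝ≥0, LipschitzWith K (fun x : EuclideanSpace ℝ (Fin 3) =>
      Real.smoothTransition (2 - ‖x‖ ^ 2 / R ^ 2) ^ 2) :=
  (contDiff_sqBallCutoff R (n := 1)).lipschitzWith_of_hasCompactSupport
    (hasCompactSupport_sqBallCutoff hR) one_ne_zero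

end Weight

/-! ### Two measure-theoretic facts: the axis is null, thin cylinders are small -/

section Measure

/-- **The axis is Lebesgue-null**: `{x : x₀² + x₁² = 0}` lies in the coordinate hyperplane
`{x₀ = 0}`, a proper subspace. [folklore] -/
theorem volume_axis_eq_zero :
    volume {x : EuclideanSpace ℝ (Fin 3) | x 0 ^ 2 + x 1 ^ 2 = 0} = 0 := by
  set L : Submodule ℝ (EuclideanSpace ℝ (Fin 3)) :=
    LinearMap.ker (EuclideanSpace.proj (0 : Fin 3) : EuclideanSpace ℝ (Fin 3) →L[ℝ] ℝ).toLinearMap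
    with hL
  have hLtop : L ≠ ⊤ := by
    intro h
    have hmem : EuclideanSpace.single (0 : Fin 3) (1 : ℝ) ∈ L := by rw [h]; trivial
    rw [hL, LinearMap.mem_ker] at hmem
    simp [EuclideanSpace.proj] at hmem
  have hnull : volume (L : Set (EuclideanSpace ℝ (Fin 3))) = 0 :=
    Measure.addHaar_submodule _ L hLtop
  refine measure_mono_null (fun x hx => ?_) hnull
  have hx' : x 0 ^ 2 + x 1 ^ 2 = 0 := hx
  have h0 : x 0 = 0 := by nlinarith [sq_nonneg (x 0), sq_nonneg (x 1)]
  change x ∈ L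
  rw [hL, LinearMap.mem_ker]
  simpa [EuclideanSpace.proj] using h0

/-- **Thin cylinders are small**: the set `{ρ ≤ a², |x|² ≤ b²}` (`a, b ≥ 0`) lies in the box
`[−a, a]² × [−b, b]` and so has volume at most `8 a² b` (volume of a box, transported through the
volume-preserving identification `EuclideanSpace ℝ (Fin 3) ≃ (Fin 3 → ℝ)`). This is the
estimate behind "`lim_{ε→0} ∫_{ε<r<2ε} … = 0`" for bounded integrands (Lemarié-Rieusset 2016,
p. 287). [folklore] -/
theorem volume_thinCylinder_le {a b : ℝ} (ha : 0 ≤ a) (hb : 0 ≤ b) :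
    volume {x : EuclideanSpace ℝ (Fin 3) | x 0 ^ 2 + x 1 ^ 2 ≤ a ^ 2 ∧ ‖x‖ ^ 2 ≤ b ^ 2} ≤
      ENNReal.ofReal (8 * a ^ 2 * b) := by
  -- the box in `Fin 3 → ℝ`
  set lo : Fin 3 → ℝ := ![-a, -a, -b] with hlo
  set hi : Fin 3 → ℝ := ![a, a, b] with hhi
  have hsub : {x : EuclideanSpace ℝ (Fin 3) | x 0 ^ 2 + x 1 ^ 2 ≤ a ^ 2 ∧ ‖x‖ ^ 2 ≤ b ^ 2} ⊆
      (WithLp.ofLp : EuclideanSpace ℝ (Fin 3) → (Fin 3 → ℝ)) ⁻¹' Icc lo hi := by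
    intro x hx
    obtain ⟨h1, h2⟩ := hx
    have hn : ‖x‖ ^ 2 = x 0 ^ 2 + x 1 ^ 2 + x 2 ^ 2 := by
      rw [EuclideanSpace.norm_sq_eq, Fin.sum_univ_three]
      simp only [Real.norm_eq_abs, sq_abs]
    have hx0 : |x 0| ≤ a := abs_le_of_sq_le_sq' (by nlinarith [sq_nonneg (x 1)]) ha |>.elim
      (fun h h' => abs_le.2 ⟨h, h'⟩)
    have hx1 : |x 1| ≤ a := abs_le_of_sq_le_sq' (by nlinarith [sq_nonneg (x 0)]) ha |>.elim
      (fun h h' => abs_le.2 ⟨h, h'⟩)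
    have hx2 : |x 2| ≤ b := abs_le_of_sq_le_sq' (by nlinarith [sq_nonneg (x 0), sq_nonneg (x 1)]) hb
      |>.elim (fun h h' => abs_le.2 ⟨h, h'⟩)
    rw [mem_preimage, mem_Icc]
    refine ⟨fun i => ?_, fun i => ?_⟩
    · fin_cases i
      · simpa [hlo] using (abs_le.1 hx0).1
      · simpa [hlo] using (abs_le.1 hx1).1
      · simpa [hlo] using (abs_le.1 hx2).1
    · fin_cases i
      · simpa [hhi] using (abs_le.1 hx0).2
      · simpa [hhi] using (abs_le.1 hx1).2
      · simpa [hhi] using (abs_le.1 hx2).2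
  have hpres := PiLp.volume_preserving_ofLp (Fin 3)
  calc volume {x : EuclideanSpace ℝ (Fin 3) | x 0 ^ 2 + x 1 ^ 2 ≤ a ^ 2 ∧ ‖x‖ ^ 2 ≤ b ^ 2}
      ≤ volume ((WithLp.ofLp : EuclideanSpace ℝ (Fin 3) → (Fin 3 → ℝ)) ⁻¹' Icc lo hi) :=
        measure_mono hsub
    _ = volume (Icc lo hi) := hpres.measure_preimage measurableSet_Icc.nullMeasurableSet
    _ = ENNReal.ofReal (8 * a ^ 2 * b) := by
        rw [Real.volume_Icc_pi, Fin.prod_univ_three]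
        simp only [hlo, hhi, Matrix.cons_val_zero, Matrix.cons_val_one, Matrix.cons_val_two,
          Matrix.head_cons, Matrix.tail_cons]
        rw [← ENNReal.ofReal_mul (by linarith), ← ENNReal.ofReal_mul (by nlinarith)]
        congr 1
        ring

end Measure

end Literature.Analysis.FluidPDE

end
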